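import Literature.NumberTheory.EllipticCurves.RingClassFieldClassNumber
import Literature.NumberTheory.NumberFields.RingClassFieldAbelian
import HarnessLib

/-!
# `K[f]` is abelian over `K`, and `𝒢_f = Gal(K[f]/K)` is commutative
# (Cox, *Primes of the form x² + ny²*, §9.A with Thm. 11.1; Gross 1991, §3)

Topic `NumberTheory/EllipticCurves` (complex multiplication / class field theory). Theorems only — no
definition, no named fact (D-0026); unconditional.

> Cox §9.A (p. 180): an order `𝒪` of conductor `f` in an imaginary quadratic field `K` "determines a
> unique Abelian extension `L` of `K`", the ring class field of `𝒪`, with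
> `C(𝒪) ≃ I_K(f)/P_{K,ℤ}(f) ≃ Gal(L/K)`; Thm. 11.1: `L = K(j(𝒪))`.

For `K` imaginary quadratic, `ι : K → ℂ` and `f ≥ 1`, the tree's `K[f] = ringClassField K ι f ⊂ ℂ`
(`HeegnerPointsOfConductor`) is `K`-isomorphic to the ring class field `R_f ⊆ K̄` of conductor `f`
(`exists_classField_algEquiv_ringClassField`, `RingClassFieldClassNumber.lean`), and `R_f/K` is abelian
(`RingClassField.isAbelianGalois_of_primeClass_eq_one_imp`, `NumberFields/RingClassFieldAbelian.lean`).
Hence: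

* `exists_abelian_classField_algEquiv_ringClassField` — the class-field model `R_f ⊆ K̄` of `K[f]`
  with `IsAbelianGalois K R_f` recorded (for arguments in `Γ_K`, e.g. inertia groups);
* `isAbelianGalois_ringClassField` — **`K[f]/K` is abelian**;
* `commute_of_mem_ringClassGal`, `isMulCommutative_ringClassGal` — Gross's `𝒢_f = Gal(K_f/K)`
  (`ringClassGal ι f`, the automorphisms of `K[f]` fixing `ι(K)`) is commutative.

HONEST FRAMING: published, proved class field theory / complex multiplication (Cox §9.A, Thm. 11.1);
nothing specific to a summit is booked here.

## References

* D. A. Cox, *Primes of the form x² + ny²*, 2nd ed. (2013), §9.A (pp. 180–181), §11.A Thm. 11.1. [Cox2013]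
* B. H. Gross, *Kolyvagin's work on modular elliptic curves* (1991), §3 (`𝒢_n = Gal(K_n/K)`). [GrossLMS1991]
* J. Neukirch, *Algebraic Number Theory* (1999), Ch. VI §7 Thm. (7.1). [NeukirchANT1999]
-/

noncomputable section

open IsDedekindDomain
open scoped NumberField IsMulCommutative

namespace Literature.NumberTheory.EllipticCurves

open Literature.NumberTheory.GaloisRepresentations
open Literature.NumberTheory.NumberFields Literature.NumberTheory.NumberFields.RingClassField
open Literature.NumberTheory.QuadraticFields.RingClass

variable {K : Type} [Field K] [NumberField K]

/-- **The class-field model of `K[f]` is abelian**: for `K` imaginary quadratic, `ι : K → ℂ` and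
`f ≥ 1` there is a finite ABELIAN `R ⊆ K̄` over `K`, unramified at every `v ∤ f`, in which a prime
`v ∤ f` splits completely iff `[𝔭_v] = 1` in `I_K(f)/P_{K,ℤ}(f)`, together with a `K`-isomorphism
`R ≃ K[f]` (the tree's `exists_classField_algEquiv_ringClassField`, with Cox §9.A "Abelian" added by
`RingClassField.isAbelianGalois_of_primeClass_eq_one_imp`).
[cite: Cox2013, §9.A (pp. 180–181) and §11.A Thm. 11.1] [cite: NeukirchANT1999, Ch. VI §7 Thm. (7.1)] -/
theorem exists_abelian_classField_algEquiv_ringClassField (hK : IsImaginaryQuadratic K) (ι : K →+* ℂ)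
    {f : ℕ} (hf : f ≠ 0) :
    ∃ R : IntermediateField K (AlgebraicClosure K), FiniteDimensional K R ∧ IsAbelianGalois K R ∧
      (∀ v : HeightOneSpectrum (𝓞 K), ¬ Ideal.span {((f : ℕ) : 𝓞 K)} ≤ v.asIdeal →
        Algebra.IsUnramifiedIn (𝓞 R) v.asIdeal) ∧
      (∀ v : HeightOneSpectrum (𝓞 K), ¬ Ideal.span {((f : ℕ) : 𝓞 K)} ≤ v.asIdeal →
        (v ∈ splitPrimes K R ↔ primeClass f v = 1)) ∧
      Nonempty (R ≃ₐ[K] ringClassField K ι f) := by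
  classical
  haveI := finite_ringClassGroup (K := K) (f := f) hK.1 hf
  obtain ⟨R, hfd, hgal, hunr, hsplit, he⟩ := exists_classField_algEquiv_ringClassField hK ι hf
  haveI := hfd
  haveI := hgal
  exact ⟨R, hfd, isAbelianGalois_of_primeClass_eq_one_imp f hf R
    (fun v hv h1 => (hsplit v hv).mpr h1), hunr, hsplit, he⟩

/-- **`K[f]` is abelian over `K`** (Cox §9.A with Thm. 11.1: the ring class field `K(j(𝒪)) = K[f]`
is *"a unique Abelian extension of `K`"*): for `K` imaginary quadratic, `ι : K → ℂ` and `f ≥ 1`,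
`ringClassField K ι f` is a finite abelian Galois extension of `K` (through `ι`).
[cite: Cox2013, §9.A (pp. 180–181) and §11.A Thm. 11.1] [cite: NeukirchANT1999, Ch. VI §7 Thm. (7.1)] -/
theorem isAbelianGalois_ringClassField (hK : IsImaginaryQuadratic K) (ι : K →+* ℂ) {f : ℕ}
    (hf : f ≠ 0) : IsAbelianGalois K (ringClassField K ι f) := by
  obtain ⟨R, hfd, hab, -, -, ⟨e⟩⟩ := exists_abelian_classField_algEquiv_ringClassField hK ι hf
  haveI := hfd
  haveI := hab
  exact IsAbelianGalois.of_algHom (e.symm : ringClassField K ι f →ₐ[K] R)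

/-- **`𝒢_n = Gal(K[n]/K)` is commutative** (Gross 1991, §3; Cox §9.A): any two automorphisms of
`K[n]` fixing `ι(K)` pointwise commute (`n ≥ 1`, `K` imaginary quadratic).
[cite: GrossLMS1991, §3 (𝒢_n = Gal(K_n/K))] [cite: Cox2013, §9.A (pp. 180–181)] -/
theorem commute_of_mem_ringClassGal (hK : IsImaginaryQuadratic K) {ι : K →+* ℂ} {n : ℕ}
    (hn : n ≠ 0) {σ τ : ringClassField K ι n ≃ₐ[ℚ] ringClassField K ι n}
    (hσ : σ ∈ ringClassGal ι n) (hτ : τ ∈ ringClassGal ι n) : σ * τ = τ * σ := by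
  haveI := isAbelianGalois_ringClassField hK ι hn
  -- upgrade `σ, τ` to `K`-algebra automorphisms
  let σ' : ringClassField K ι n ≃ₐ[K] ringClassField K ι n :=
    { σ with commutes' := fun k => smul_algebraMap_of_mem_ringClassGal hσ k }
  let τ' : ringClassField K ι n ≃ₐ[K] ringClassField K ι n :=
    { τ with commutes' := fun k => smul_algebraMap_of_mem_ringClassGal hτ k }
  have hσ' : ∀ y, σ' y = σ y := fun _ => rfl
  have hτ' : ∀ y, τ' y = τ y := fun _ => rfl
  have h : σ' * τ' = τ' * σ' := IsMulCommutative.is_comm.comm σ' τ'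
  refine AlgEquiv.ext fun x => ?_
  have hx := AlgEquiv.congr_fun h x
  simp only [AlgEquiv.mul_apply, hσ', hτ'] at hx
  rw [AlgEquiv.mul_apply, AlgEquiv.mul_apply]
  exact hx

/-- **`𝒢_n` is a commutative group** (Gross 1991, §3): the subgroup `ringClassGal ι n` of
`Aut(K[n])` is commutative. [cite: GrossLMS1991, §3 (𝒢_n = Gal(K_n/K))] [cite: Cox2013, §9.A (pp. 180–181)] -/
theorem isMulCommutative_ringClassGal (hK : IsImaginaryQuadratic K) (ι : K →+* ℂ) {n : ℕ}
    (hn : n ≠ 0) : IsMulCommutative (ringClassGal ι n) :=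
  ⟨⟨fun a b => Subtype.ext (commute_of_mem_ringClassGal hK hn a.2 b.2)⟩⟩

end Literature.NumberTheory.EllipticCurves

end
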